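import Summits.BirchSwinnertonDyer.BirchSwinnertonDyer.Theorems.CountingDoorF2AtThreeIntModelReduction
import Summits.BirchSwinnertonDyer.BirchSwinnertonDyer.Theorems.CountingDoorF2AtThreeDoorFamily
import HarnessLib

/-!
# BirchSwinnertonDyer / CountingDoorF2AtThree — MEMBER-WISE genericity on the refined door classes:
# every member `a ≡ (1,0,1,0) (3)`, `≡ (1,2,4,3) (7)`, `≡ (9,8,3,3) (13)` of Bhargava–Ho's `F₂` has
# `E_a(ℚ)_tors = 0` and `ℤ`-independent marked points `P₁ = (a₂,0)`, `P₂ = (a₂',0)` (`rank ≥ 2`)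

Cell bsd-rank2, seat bsd-rank2-eng-2 GEN 3; `--supports` crux I1 `SelmerThreeAverageLargeF2`
(stmt-BirchSwinnertonDyer-19440) of `route-BirchSwinnertonDyer-CountingDoorF2AtThree`. PURPOSE: the
route's chains `I1 ∧ I2 ⇒ D9 ⇒ leaf` consume the fact pack `LargeFamilyInputsF2` (Bhargava–Ho 2022
Thm. 9.1/10.1: `torsionOrder = 1 ∧ 2 ≤ rank` for 100 % of members) only through the density-one set of
GENERIC members; on the door family of record (class `(1,0,1,0) mod 3` ⊃ `(7,0,4,0) mod 9`, class
`(1,2,4,3) mod 7`) refined by ONE further class `(9,8,3,3) mod 13` — the class of the certified member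
`a* = (−524, 450, −374, 3825)` — genericity is a THEOREM for EVERY member, by reduction modulo `3`,
`7`, `13` (companion file `CountingDoorF2AtThreeIntModelReduction`):

* TORSION: a rational point of prime order `q` forces `q ∣ #Ẽ(𝔽_ℓ)` at a good `ℓ ≠ q` (AEC
  VII.3.1(b)); `#Ẽ(𝔽₃) = 6` (`card_rep₃_three`), `#Ẽ(𝔽₇) = 8` (`card_rep₇_seven`), `#Ẽ(𝔽₁₃) = 21`
  (`card_rep₁₃_thirteen`, kernel-decided) leave no `q`.
* INDEPENDENCE (`3`-descent on a torsion-free `E(ℚ)`): a dependency would put one of `P₁`, `P₁ + P₂`,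
  `P₁ + 2P₂`, `P₂` in `3E(ℚ)`; but `(#Ẽ/3) • ū ≠ Õ` — at `3` (`Ẽ: y² + xy = x³ − x`, `P̄₁ = (0,0)` of
  order `2`, `P̄₂ = (1,0)` of order `3`): `2(P̄₁+P̄₂), 2(P̄₁+2P̄₂), 2P̄₂ ≠ Õ` (`cert_rep₃`); at `13`
  (`Ẽ: y² + 9xy + 3y = x³ − 97x + 264`, `P̄₁ = (8,0)` of order `21`): `7P̄₁ ≠ Õ` (`cert_rep₁₃`) — all
  four by `decide +kernel` on Mathlib's group law over `ZMod ℓ`.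
* `params_torsionOrder_eq_one_and_two_le_rank_of_classes` — the conjunction
  `a.curve.torsionOrder = 1 ∧ 2 ≤ a.curve.mordellWeilRank` (Mordell–Weil: tree theorem
  `module_finite_point_holds`), the exact member-wise shape of `GenericMembersLargeF2`'s predicate.

THEOREMS ONLY (no definition, no named fact, no `sorry`). PARTITION: none — r_an ≥ 2, summit axis S0
(D-0036(1) funded rung); TWIN (D-0056): n/a. B1 honesty: rank ≥ 2 and trivial torsion for an explicit
congruence family of curves with two marked points, by reduction mod `3·7·13`; nothing family-infinite
about Selmer averages or root numbers; nothing reads an analytic rank; no S0 motion.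

References: M. Bhargava, W. Ho, arXiv:2207.03309 §1, Thm. 10.1 [BhargavaHo2022]; J. H. Silverman,
*AEC* (2009) VII.2.1, VII.3.1(b), VIII.6.7 [SilvermanAEC2009].
-/

set_option linter.dupNamespace false

noncomputable section

open scoped Classical
open WeierstrassCurve Literature.NumberTheory.EllipticCurves
  Literature.NumberTheory.EllipticCurves.BhargavaHo2022
  Summit.BirchSwinnertonDyer.Rank2

namespace Summit.BirchSwinnertonDyer.BirchSwinnertonDyer.Theorems

/-! ### §1 The three class representatives: `𝔽₃`, `𝔽₇`, `𝔽₁₃` numerics (kernel-decided) -/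

/-- The integer model of the representative `(9, 8, 3, 3)` of the class of `a*` modulo `13` is
`y² + 9xy + 3y = x³ − 97x + 264` (`[9, 0, 3, -97, 264]`). [cite: BhargavaHo2022, §1 (definition of F₂)] -/
theorem curveInt_rep₁₃ : (⟨9, 8, 3, 3⟩ : Params).curveInt = ⟨9, 0, 3, -97, 264⟩ := by
  simp [Params.curveInt]

/-- Its discriminant is `-2920807899 = -(3³)·108178071`… whatever its factorisation, `13 ∤ Δ`.
[cite: BhargavaHo2022, §1 (the discriminant polynomial Δ)] -/
theorem not_thirteen_dvd_Δ_rep₁₃ : ¬ ((13 : ℤ) ∣ (⟨9, 8, 3, 3⟩ : Params).curveInt.Δ) := by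
  rw [curveInt_rep₁₃]
  simp [WeierstrassCurve.Δ, WeierstrassCurve.b₂, WeierstrassCurve.b₄, WeierstrassCurve.b₆,
    WeierstrassCurve.b₈]

/-- `#Ẽ(𝔽₁₃) = 21` for `y² + 9xy + 3y = x³ − 97x + 264` (kernel-decided through
`WeierstrassCurve.natCard_point_eq_one_add_card` and `card_sol_eq_sum_euler`). [folklore] -/
theorem card_rep₁₃_thirteen :
    Nat.card (((⟨9, 0, 3, -97, 264⟩ : WeierstrassCurve ℤ).map
      (Int.castRingHom (ZMod 13))).toAffine.Point) = 21 := by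
  rw [@WeierstrassCurve.natCard_point_eq_one_add_card (ZMod 13) (@ZMod.instField 13 ⟨by norm_num⟩) _ _ _
    (by decide +kernel), @card_sol_eq_sum_euler (ZMod 13) (@ZMod.instField 13 ⟨by norm_num⟩) _ _
    (by rw [ZMod.ringChar_zmod_n]; decide), ZMod.card]
  decide +kernel

/-- The reduced curve `y² + xy = x³ − x` over `𝔽₃` (class `(1,0,1,0) mod 3`) is nonsingular. [folklore] -/
theorem Δ_rep₃_three_ne_zero :
    ((⟨1, 0, 0, -1, 0⟩ : WeierstrassCurve ℤ).map (Int.castRingHom (ZMod 3))).Δ ≠ 0 := by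
  decide +kernel

/-- The reduced curve `y² + 9xy + 3y = x³ − 97x + 264 ≡ y² + 9xy + 3y = x³ + 7x + 4` over `𝔽₁₃`
(class `(9,8,3,3) mod 13`) is nonsingular. [folklore] -/
theorem Δ_rep₁₃_thirteen_ne_zero :
    ((⟨9, 0, 3, -97, 264⟩ : WeierstrassCurve ℤ).map (Int.castRingHom (ZMod 13))).Δ ≠ 0 := by
  decide +kernel

/-- `P̄₁ = (0,0)` lies on `y² + xy = x³ − x` over `𝔽₃`. [folklore] -/
theorem nonsingular_rep₃_P₁ :
    ((⟨1, 0, 0, -1, 0⟩ : WeierstrassCurve ℤ).map (Int.castRingHom (ZMod 3))).toAffine.Nonsingular 0 0 :=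
  (Affine.equation_iff_nonsingular_of_Δ_ne_zero Δ_rep₃_three_ne_zero).mp
    (by rw [Affine.equation_iff]; decide +kernel)

/-- `P̄₂ = (1,0)` lies on `y² + xy = x³ − x` over `𝔽₃`. [folklore] -/
theorem nonsingular_rep₃_P₂ :
    ((⟨1, 0, 0, -1, 0⟩ : WeierstrassCurve ℤ).map (Int.castRingHom (ZMod 3))).toAffine.Nonsingular 1 0 :=
  (Affine.equation_iff_nonsingular_of_Δ_ne_zero Δ_rep₃_three_ne_zero).mp
    (by rw [Affine.equation_iff]; decide +kernel)

/-- `P̄₁ = (8,0)` lies on the reduced curve of the class `(9,8,3,3)` over `𝔽₁₃`. [folklore] -/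
theorem nonsingular_rep₁₃_P₁ :
    ((⟨9, 0, 3, -97, 264⟩ : WeierstrassCurve ℤ).map (Int.castRingHom (ZMod 13))).toAffine.Nonsingular 8 0 :=
  (Affine.equation_iff_nonsingular_of_Δ_ne_zero Δ_rep₁₃_thirteen_ne_zero).mp
    (by rw [Affine.equation_iff]; decide +kernel)

/-- **The `𝔽₃` half of the independence certificate** on `Ẽ: y² + xy = x³ − x`, `#Ẽ(𝔽₃) = 6`,
`P̄₁ = (0,0)` (of order `2`), `P̄₂ = (1,0)` (of order `3`): `2(P̄₁ + P̄₂) ≠ Õ`, `2(P̄₁ + 2P̄₂) ≠ Õ`,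
`2P̄₂ ≠ Õ` (kernel computation with Mathlib's group law). [folklore] -/
theorem cert_rep₃ :
    (2 : ℕ) • ((Affine.Point.some 0 0 nonsingular_rep₃_P₁ :
        ((⟨1, 0, 0, -1, 0⟩ : WeierstrassCurve ℤ).map (Int.castRingHom (ZMod 3))).toAffine.Point) +
        Affine.Point.some 1 0 nonsingular_rep₃_P₂) ≠ 0 ∧
    (2 : ℕ) • ((Affine.Point.some 0 0 nonsingular_rep₃_P₁ :
        ((⟨1, 0, 0, -1, 0⟩ : WeierstrassCurve ℤ).map (Int.castRingHom (ZMod 3))).toAffine.Point) +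
        2 • Affine.Point.some 1 0 nonsingular_rep₃_P₂) ≠ 0 ∧
    (2 : ℕ) • (Affine.Point.some 1 0 nonsingular_rep₃_P₂ :
        ((⟨1, 0, 0, -1, 0⟩ : WeierstrassCurve ℤ).map (Int.castRingHom (ZMod 3))).toAffine.Point) ≠ 0 := by
  refine ⟨?_, ?_, ?_⟩ <;> decide +kernel

/-- **The `𝔽₁₃` half of the independence certificate** on the reduced curve of the class
`(9,8,3,3)`, `#Ẽ(𝔽₁₃) = 21`, `P̄₁ = (8,0)` (of order `21`): `7P̄₁ ≠ Õ`. [folklore] -/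
theorem cert_rep₁₃ :
    haveI : Fact (Nat.Prime 13) := ⟨by norm_num⟩
    (7 : ℕ) • (Affine.Point.some 8 0 nonsingular_rep₁₃_P₁ :
        ((⟨9, 0, 3, -97, 264⟩ : WeierstrassCurve ℤ).map (Int.castRingHom (ZMod 13))).toAffine.Point) ≠ 0 := by
  decide +kernel

/-! ### §2 Member-wise: every member of the three classes has `E(ℚ)_tors = 0` and `P₁, P₂` independent -/

section Member

variable (a : Params)

/-- `a ≡ (1,0,1,0) (mod 3)` ⟹ `3 ∤ Δ(a)` (`Δ ≡ Δ(1,0,1,0) = 65`). [cite: BhargavaHo2022, §1 (subfamilies defined by congruence conditions)] -/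
theorem params_not_three_dvd_Δ_of_class (h₁ : (a.a₁ : ZMod 3) = 1) (h₂ : (a.a₂ : ZMod 3) = 0)
    (h₂' : (a.a₂' : ZMod 3) = 1) (h₃ : (a.a₃ : ZMod 3) = 0) : ¬ ((3 : ℤ) ∣ a.curveInt.Δ) := by
  have h := F2Member.dvd_Δ_iff_of_cast_eq (a := a) (r := ⟨1, 0, 1, 0⟩) (n := 3)
    (by rw [h₁]; rfl) (by rw [h₂]; rfl) (by rw [h₂']; rfl) (by rw [h₃]; rfl)
  rw [show ((3 : ℕ) : ℤ) = 3 from rfl] at h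
  rw [h, Δ_rep₃]; norm_num

/-- `a ≡ (1,2,4,3) (mod 7)` ⟹ `7 ∤ Δ(a)` (`Δ ≡ Δ(1,2,4,3) = 4964`). [cite: BhargavaHo2022, §1 (subfamilies defined by congruence conditions)] -/
theorem params_not_seven_dvd_Δ_of_class (h₁ : (a.a₁ : ZMod 7) = 1) (h₂ : (a.a₂ : ZMod 7) = 2)
    (h₂' : (a.a₂' : ZMod 7) = 4) (h₃ : (a.a₃ : ZMod 7) = 3) : ¬ ((7 : ℤ) ∣ a.curveInt.Δ) := by
  have h := F2Member.dvd_Δ_iff_of_cast_eq (a := a) (r := ⟨1, 2, 4, 3⟩) (n := 7)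
    (by rw [h₁]; rfl) (by rw [h₂]; rfl) (by rw [h₂']; rfl) (by rw [h₃]; rfl)
  rw [show ((7 : ℕ) : ℤ) = 7 from rfl] at h
  rw [h, Δ_rep₇]; norm_num

/-- `a ≡ (9,8,3,3) (mod 13)` ⟹ `13 ∤ Δ(a)`. [cite: BhargavaHo2022, §1 (subfamilies defined by congruence conditions)] -/
theorem params_not_thirteen_dvd_Δ_of_class (h₁ : (a.a₁ : ZMod 13) = 9) (h₂ : (a.a₂ : ZMod 13) = 8)
    (h₂' : (a.a₂' : ZMod 13) = 3) (h₃ : (a.a₃ : ZMod 13) = 3) : ¬ ((13 : ℤ) ∣ a.curveInt.Δ) := by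
  have h := F2Member.dvd_Δ_iff_of_cast_eq (a := a) (r := ⟨9, 8, 3, 3⟩) (n := 13)
    (by rw [h₁]; rfl) (by rw [h₂]; rfl) (by rw [h₂']; rfl) (by rw [h₃]; rfl)
  rw [show ((13 : ℕ) : ℤ) = 13 from rfl] at h
  rw [h]; exact not_thirteen_dvd_Δ_rep₁₃

/-- The point counts of the reductions of a member of the three classes: `#Ẽ_a(𝔽₃) = 6`,
`#Ẽ_a(𝔽₇) = 8`, `#Ẽ_a(𝔽₁₃) = 21` (class-constancy of the reduction). [cite: BhargavaHo2022, §1 (subfamilies defined by congruence conditions)] -/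
theorem params_card_reductions_of_classes
    (h₁ : (a.a₁ : ZMod 3) = 1) (h₂ : (a.a₂ : ZMod 3) = 0) (h₂' : (a.a₂' : ZMod 3) = 1)
    (h₃ : (a.a₃ : ZMod 3) = 0)
    (s₁ : (a.a₁ : ZMod 7) = 1) (s₂ : (a.a₂ : ZMod 7) = 2) (s₂' : (a.a₂' : ZMod 7) = 4)
    (s₃ : (a.a₃ : ZMod 7) = 3)
    (t₁ : (a.a₁ : ZMod 13) = 9) (t₂ : (a.a₂ : ZMod 13) = 8) (t₂' : (a.a₂' : ZMod 13) = 3)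
    (t₃ : (a.a₃ : ZMod 13) = 3) :
    Nat.card (a.curveInt.map (Int.castRingHom (ZMod 3))).toAffine.Point = 6 ∧
    Nat.card (a.curveInt.map (Int.castRingHom (ZMod 7))).toAffine.Point = 8 ∧
    Nat.card (a.curveInt.map (Int.castRingHom (ZMod 13))).toAffine.Point = 21 := by
  refine ⟨?_, ?_, ?_⟩
  · rw [F2Member.curveInt_map_eq_of_cast_eq (a := a) (r := ⟨1, 0, 1, 0⟩) (n := 3)
      (by rw [h₁]; rfl) (by rw [h₂]; rfl) (by rw [h₂']; rfl) (by rw [h₃]; rfl), curveInt_rep₃]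
    exact card_rep₃_three
  · rw [F2Member.curveInt_map_eq_of_cast_eq (a := a) (r := ⟨1, 2, 4, 3⟩) (n := 7)
      (by rw [s₁]; rfl) (by rw [s₂]; rfl) (by rw [s₂']; rfl) (by rw [s₃]; rfl), curveInt_rep₇]
    exact card_rep₇_seven
  · rw [F2Member.curveInt_map_eq_of_cast_eq (a := a) (r := ⟨9, 8, 3, 3⟩) (n := 13)
      (by rw [t₁]; rfl) (by rw [t₂]; rfl) (by rw [t₂']; rfl) (by rw [t₃]; rfl), curveInt_rep₁₃]
    exact card_rep₁₃_thirteen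

/-- **`E_a(ℚ)` is torsion-free for every member of the classes `(1,0,1,0) mod 3`, `(1,2,4,3) mod 7`,
`(9,8,3,3) mod 13`**: a rational point of prime order `q` would give `q ∣ #Ẽ(𝔽_ℓ)` at a good prime
`ℓ ≠ q` (Silverman *AEC* VII.3.1(b)); but `#Ẽ(𝔽₁₃) = 21` is odd, `3 ∤ #Ẽ(𝔽₇) = 8`, and
`q ∤ #Ẽ(𝔽₃) = 6` for `q ≥ 5`. [cite: SilvermanAEC2009, Prop. VII.3.1(b)] -/
theorem params_torsionFree_of_classes
    (h₁ : (a.a₁ : ZMod 3) = 1) (h₂ : (a.a₂ : ZMod 3) = 0) (h₂' : (a.a₂' : ZMod 3) = 1)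
    (h₃ : (a.a₃ : ZMod 3) = 0)
    (s₁ : (a.a₁ : ZMod 7) = 1) (s₂ : (a.a₂ : ZMod 7) = 2) (s₂' : (a.a₂' : ZMod 7) = 4)
    (s₃ : (a.a₃ : ZMod 7) = 3)
    (t₁ : (a.a₁ : ZMod 13) = 9) (t₂ : (a.a₂ : ZMod 13) = 8) (t₂' : (a.a₂' : ZMod 13) = 3)
    (t₃ : (a.a₃ : ZMod 13) = 3)
    (T : a.curve.toAffine.Point) (hT : IsOfFinAddOrder T) : T = 0 := by
  obtain ⟨c₃, c₇, c₁₃⟩ := params_card_reductions_of_classes a h₁ h₂ h₂' h₃ s₁ s₂ s₂' s₃ t₁ t₂ t₂' t₃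
  refine intModel_torsionFree_of_reductions a.curveInt (fun q hq => ?_) T hT
  by_cases hq2 : q = 2
  · subst hq2
    exact ⟨13, ⟨by norm_num⟩, by norm_num, params_not_thirteen_dvd_Δ_of_class a t₁ t₂ t₂' t₃,
      by rw [c₁₃]; norm_num⟩
  by_cases hq3 : q = 3
  · subst hq3
    exact ⟨7, ⟨by norm_num⟩, by norm_num, params_not_seven_dvd_Δ_of_class a s₁ s₂ s₂' s₃,
      by rw [c₇]; norm_num⟩
  · refine ⟨3, ⟨by norm_num⟩, fun h => hq3 h.symm, params_not_three_dvd_Δ_of_class a h₁ h₂ h₂' h₃, ?_⟩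
    rw [c₃, show (6 : ℕ) = 2 * 3 from rfl]
    intro hdvd
    rcases (Nat.Prime.dvd_mul hq).mp hdvd with h | h
    · exact hq2 ((Nat.prime_dvd_prime_iff_eq hq Nat.prime_two).mp h)
    · exact hq3 ((Nat.prime_dvd_prime_iff_eq hq Nat.prime_three).mp h)

/-- **The reduction at `3` of a member of the class `(1,0,1,0) mod 3`** lands in `Ẽ: y² + xy = x³ − x`
over `𝔽₃` and sends `P₁ = (a₂, 0) ↦ (0, 0)`, `P₂ = (a₂', 0) ↦ (1, 0)`.
[cite: SilvermanAEC2009, Prop. VII.2.1] -/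
theorem params_exists_red_three (h : a.IsMember)
    (h₁ : (a.a₁ : ZMod 3) = 1) (h₂ : (a.a₂ : ZMod 3) = 0) (h₂' : (a.a₂' : ZMod 3) = 1)
    (h₃ : (a.a₃ : ZMod 3) = 0) :
    ∃ red : a.curve.toAffine.Point →+
        ((⟨1, 0, 0, -1, 0⟩ : WeierstrassCurve ℤ).map (Int.castRingHom (ZMod 3))).toAffine.Point,
      red (a.markedPoint₁ h) = .some 0 0 nonsingular_rep₃_P₁ ∧
      red (a.markedPoint₂ h) = .some 1 0 nonsingular_rep₃_P₂ := by
  have hΔ := params_not_three_dvd_Δ_of_class a h₁ h₂ h₂' h₃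
  haveI : Fact (Nat.Prime 3) := ⟨Nat.prime_three⟩
  obtain ⟨red, hsome, -⟩ := intModel_exists_reductionHom a.curveInt 3 hΔ
  have hE : a.curveInt.map (Int.castRingHom (ZMod 3)) =
      (⟨1, 0, 0, -1, 0⟩ : WeierstrassCurve ℤ).map (Int.castRingHom (ZMod 3)) := by
    rw [F2Member.curveInt_map_eq_of_cast_eq (a := a) (r := ⟨1, 0, 1, 0⟩) (n := 3)
      (by rw [h₁]; rfl) (by rw [h₂]; rfl) (by rw [h₂']; rfl) (by rw [h₃]; rfl), curveInt_rep₃]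
  refine ⟨(Affine.Point.congrEquiv hE).toAddMonoidHom.comp red, ?_, ?_⟩
  · -- `P₁ = (a₂, 0) ↦ (ā₂, 0) = (0, 0)`
    have hP : a.curve.toAffine.Nonsingular ((a.a₂ : ℤ) : ℚ) ((0 : ℤ) : ℚ) := by
      rw [Int.cast_zero]
      exact (Affine.equation_iff_nonsingular_of_Δ_ne_zero
        (by rw [Params.curve_Δ]; exact_mod_cast h)).mp a.equation_markedPoint₁
    have e1 : a.markedPoint₁ h = .some _ _ hP := point_some_congr rfl (Int.cast_zero).symm
    have e2 := hsome a.a₂ 0 hP (intModel_nonsingular_reduce a.curveInt 3 hΔ _ _ hP)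
    refine (congrArg (Affine.Point.congrEquiv hE) ((congrArg red e1).trans e2)).trans ?_
    rw [Affine.Point.congrEquiv_some]
    exact point_some_congr h₂ (by simp)
  · -- `P₂ = (a₂', 0) ↦ (ā₂', 0) = (1, 0)`
    have hP : a.curve.toAffine.Nonsingular ((a.a₂' : ℤ) : ℚ) ((0 : ℤ) : ℚ) := by
      rw [Int.cast_zero]
      exact (Affine.equation_iff_nonsingular_of_Δ_ne_zero
        (by rw [Params.curve_Δ]; exact_mod_cast h)).mp a.equation_markedPoint₂
    have e1 : a.markedPoint₂ h = .some _ _ hP := point_some_congr rfl (Int.cast_zero).symm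
    have e2 := hsome a.a₂' 0 hP (intModel_nonsingular_reduce a.curveInt 3 hΔ _ _ hP)
    refine (congrArg (Affine.Point.congrEquiv hE) ((congrArg red e1).trans e2)).trans ?_
    rw [Affine.Point.congrEquiv_some]
    exact point_some_congr h₂' (by simp)

/-- **The reduction at `13` of a member of the class `(9,8,3,3) mod 13`** lands in
`Ẽ: y² + 9xy + 3y = x³ − 97x + 264` over `𝔽₁₃` and sends `P₁ = (a₂, 0) ↦ (8, 0)`.
[cite: SilvermanAEC2009, Prop. VII.2.1] -/
theorem params_exists_red_thirteen [Fact (Nat.Prime 13)] (h : a.IsMember)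
    (t₁ : (a.a₁ : ZMod 13) = 9) (t₂ : (a.a₂ : ZMod 13) = 8) (t₂' : (a.a₂' : ZMod 13) = 3)
    (t₃ : (a.a₃ : ZMod 13) = 3) :
    ∃ red : a.curve.toAffine.Point →+
        ((⟨9, 0, 3, -97, 264⟩ : WeierstrassCurve ℤ).map (Int.castRingHom (ZMod 13))).toAffine.Point,
      red (a.markedPoint₁ h) = .some 8 0 nonsingular_rep₁₃_P₁ := by
  have hΔ := params_not_thirteen_dvd_Δ_of_class a t₁ t₂ t₂' t₃
  obtain ⟨red, hsome, -⟩ := intModel_exists_reductionHom a.curveInt 13 hΔ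
  have hE : a.curveInt.map (Int.castRingHom (ZMod 13)) =
      (⟨9, 0, 3, -97, 264⟩ : WeierstrassCurve ℤ).map (Int.castRingHom (ZMod 13)) := by
    rw [F2Member.curveInt_map_eq_of_cast_eq (a := a) (r := ⟨9, 8, 3, 3⟩) (n := 13)
      (by rw [t₁]; rfl) (by rw [t₂]; rfl) (by rw [t₂']; rfl) (by rw [t₃]; rfl), curveInt_rep₁₃]
  refine ⟨(Affine.Point.congrEquiv hE).toAddMonoidHom.comp red, ?_⟩
  have hP : a.curve.toAffine.Nonsingular ((a.a₂ : ℤ) : ℚ) ((0 : ℤ) : ℚ) := by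
    rw [Int.cast_zero]
    exact (Affine.equation_iff_nonsingular_of_Δ_ne_zero
      (by rw [Params.curve_Δ]; exact_mod_cast h)).mp a.equation_markedPoint₁
  have e1 : a.markedPoint₁ h = .some _ _ hP := point_some_congr rfl (Int.cast_zero).symm
  have e2 := hsome a.a₂ 0 hP (intModel_nonsingular_reduce a.curveInt 13 hΔ _ _ hP)
  refine (congrArg (Affine.Point.congrEquiv hE) ((congrArg red e1).trans e2)).trans ?_
  rw [Affine.Point.congrEquiv_some]
  exact point_some_congr t₂ (by simp)

/-- **The marked points of every member of the three classes are `ℤ`-linearly independent** (the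
`3`-descent certificate `linearIndependent_pair_of_three_descent` run on the reductions at `3` — for
the representatives `P₁ + P₂`, `P₁ + 2P₂`, `P₂` — and at `13` — for `P₁`; `E(ℚ)` is torsion-free by
`params_torsionFree_of_classes`). [cite: SilvermanAEC2009, Prop. VII.2.1 and Thm. VIII.6.7] -/
theorem params_linearIndependent_markedPoints_of_classes (h : a.IsMember)
    (h₁ : (a.a₁ : ZMod 3) = 1) (h₂ : (a.a₂ : ZMod 3) = 0) (h₂' : (a.a₂' : ZMod 3) = 1)
    (h₃ : (a.a₃ : ZMod 3) = 0)
    (s₁ : (a.a₁ : ZMod 7) = 1) (s₂ : (a.a₂ : ZMod 7) = 2) (s₂' : (a.a₂' : ZMod 7) = 4)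
    (s₃ : (a.a₃ : ZMod 7) = 3)
    (t₁ : (a.a₁ : ZMod 13) = 9) (t₂ : (a.a₂ : ZMod 13) = 8) (t₂' : (a.a₂' : ZMod 13) = 3)
    (t₃ : (a.a₃ : ZMod 13) = 3) :
    LinearIndependent ℤ ![a.markedPoint₁ h, a.markedPoint₂ h] := by
  haveI : Fact (Nat.Prime 13) := ⟨by norm_num⟩
  obtain ⟨r₃, hr₁, hr₂⟩ := params_exists_red_three a h h₁ h₂ h₂' h₃
  obtain ⟨r₁₃, hr₁₃⟩ := params_exists_red_thirteen a h t₁ t₂ t₂' t₃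
  obtain ⟨c1, c2, c3⟩ := cert_rep₃
  refine linearIndependent_pair_of_three_descent
    (params_torsionFree_of_classes a h₁ h₂ h₂' h₃ s₁ s₂ s₂' s₃ t₁ t₂ t₂' t₃) _ _ r₁₃ r₃ r₃ r₃
    ?_ ?_ ?_ ?_ ?_ ?_ ?_ ?_
  · rw [card_rep₁₃_thirteen]; norm_num
  · rw [card_rep₁₃_thirteen, hr₁₃]; exact cert_rep₁₃
  · rw [card_rep₃_three]; norm_num
  · rw [card_rep₃_three, map_add, hr₁, hr₂]; exact c1
  · rw [card_rep₃_three]; norm_num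
  · rw [card_rep₃_three, map_add, map_nsmul, hr₁, hr₂]; exact c2
  · rw [card_rep₃_three]; norm_num
  · rw [card_rep₃_three, hr₂]; exact c3

/-- **`rank E_a(ℚ) ≥ 2` for every member of the three classes** (Mordell–Weil, tree theorem
`module_finite_point_holds`, and two independent points). [cite: SilvermanAEC2009, Thm. VIII.6.7] -/
theorem params_two_le_mordellWeilRank_of_classes (h : a.IsMember)
    (h₁ : (a.a₁ : ZMod 3) = 1) (h₂ : (a.a₂ : ZMod 3) = 0) (h₂' : (a.a₂' : ZMod 3) = 1)
    (h₃ : (a.a₃ : ZMod 3) = 0)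
    (s₁ : (a.a₁ : ZMod 7) = 1) (s₂ : (a.a₂ : ZMod 7) = 2) (s₂' : (a.a₂' : ZMod 7) = 4)
    (s₃ : (a.a₃ : ZMod 7) = 3)
    (t₁ : (a.a₁ : ZMod 13) = 9) (t₂ : (a.a₂ : ZMod 13) = 8) (t₂' : (a.a₂' : ZMod 13) = 3)
    (t₃ : (a.a₃ : ZMod 13) = 3) :
    2 ≤ a.curve.mordellWeilRank := by
  haveI : a.curve.IsElliptic := Params.isElliptic_curve h
  haveI : Fact (Nat.Prime 13) := ⟨by norm_num⟩
  -- the tree glue is stated for the classical `DecidableEq ℚ`; the instances are equal: `convert`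
  refine two_le_mordellWeilRank_of_linearIndependent a.curve a.curve.module_finite_point_holds
    (P := a.markedPoint₁ h) (Q := a.markedPoint₂ h) ?_
  have key := params_linearIndependent_markedPoints_of_classes a h h₁ h₂ h₂' h₃ s₁ s₂ s₂' s₃
    t₁ t₂ t₂' t₃
  convert key

/-- **`E_a(ℚ)_tors = 0`, i.e. `#E_a(ℚ)_tors = 1`, for every member of the three classes.**
[cite: SilvermanAEC2009, Prop. VII.3.1(b)] -/
theorem params_torsionOrder_eq_one_of_classes
    (h₁ : (a.a₁ : ZMod 3) = 1) (h₂ : (a.a₂ : ZMod 3) = 0) (h₂' : (a.a₂' : ZMod 3) = 1)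
    (h₃ : (a.a₃ : ZMod 3) = 0)
    (s₁ : (a.a₁ : ZMod 7) = 1) (s₂ : (a.a₂ : ZMod 7) = 2) (s₂' : (a.a₂' : ZMod 7) = 4)
    (s₃ : (a.a₃ : ZMod 7) = 3)
    (t₁ : (a.a₁ : ZMod 13) = 9) (t₂ : (a.a₂ : ZMod 13) = 8) (t₂' : (a.a₂' : ZMod 13) = 3)
    (t₃ : (a.a₃ : ZMod 13) = 3) :
    a.curve.torsionOrder = 1 := by
  have htf := params_torsionFree_of_classes a h₁ h₂ h₂' h₃ s₁ s₂ s₂' s₃ t₁ t₂ t₂' t₃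
  -- `torsionOrder` reads the group law through the classical `DecidableEq ℚ`, `htf` through `Rat`'s
  -- instance; the instances are equal (`Subsingleton`): `convert`
  refine torsionOrder_eq_one_of_forall_isOfFinAddOrder a.curve fun T hT => htf T ?_
  convert hT

/-- **Member-wise genericity on the refined door classes.** Every member `a` of Bhargava–Ho's `F₂` with
`a ≡ (1,0,1,0) (mod 3)`, `a ≡ (1,2,4,3) (mod 7)` and `a ≡ (9,8,3,3) (mod 13)` has trivial rational
torsion and Mordell–Weil rank `≥ 2` — the two 100 % statements of Bhargava–Ho's Thm. 10.1 for `F₂`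
(`LargeFamilyInputsF2`'s first conjunct) as a THEOREM on these classes, member by member, from
reduction modulo `3`, `7`, `13` alone. [cite: BhargavaHo2022, Thm. 10.1] [cite: SilvermanAEC2009, Prop. VII.3.1(b) and Thm. VIII.6.7] -/
theorem params_torsionOrder_eq_one_and_two_le_rank_of_classes (h : a.IsMember)
    (h₁ : (a.a₁ : ZMod 3) = 1) (h₂ : (a.a₂ : ZMod 3) = 0) (h₂' : (a.a₂' : ZMod 3) = 1)
    (h₃ : (a.a₃ : ZMod 3) = 0)
    (s₁ : (a.a₁ : ZMod 7) = 1) (s₂ : (a.a₂ : ZMod 7) = 2) (s₂' : (a.a₂' : ZMod 7) = 4)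
    (s₃ : (a.a₃ : ZMod 7) = 3)
    (t₁ : (a.a₁ : ZMod 13) = 9) (t₂ : (a.a₂ : ZMod 13) = 8) (t₂' : (a.a₂' : ZMod 13) = 3)
    (t₃ : (a.a₃ : ZMod 13) = 3) :
    a.curve.torsionOrder = 1 ∧ 2 ≤ a.curve.mordellWeilRank :=
  ⟨params_torsionOrder_eq_one_of_classes a h₁ h₂ h₂' h₃ s₁ s₂ s₂' s₃ t₁ t₂ t₂' t₃,
    params_two_le_mordellWeilRank_of_classes a h h₁ h₂ h₂' h₃ s₁ s₂ s₂' s₃ t₁ t₂ t₂' t₃⟩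

end Member

end Summit.BirchSwinnertonDyer.BirchSwinnertonDyer.Theorems

end
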